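import Summits.CriticalPhenomena.CardyFormulaZ2.Theorems.CardyComplexConeEdgePrecompactUFRSJunctionGate

/-!
# The junction funnel, part A: the `×2`-scaled medial picture (pure `ℤ²` combinatorics)
(line `qkz-strip-boundary-arm` of crux `CardyComplexCone.EdgePrecompact`, stmt-CriticalPhenomena-11387;
first file of the registered sub-goal S2 = `ufrs_junctionFunnel` of the per-scale junction bound
HJ-S, lead c5, wave 4; registered anchor `exists_scaleTwo_JF`)

The funnel says that on the junction gate (`…UFRSJunctionGate.lean`) every orbit stretch of
Smirnov's successor map `nextCorner β` crossing the annulus passes through the corner `c₀` of the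
gate. Its proof (parts B, C) is a discrete Jordan-curve argument by the lattice winding number
`walkWinding` of `Literature/Probability/Percolation/PlanarDuality.lean`, run on the lattice `ℤ²`
SCALED BY TWO, in which vertices `v ↦ 2v`, edge midpoints `{x, y} ↦ x + y` and face centres
`f ↦ 2f + (1,1)` are all lattice points, so that an open path `P` (edge `{x,y}` ↦
`2x → x+y → 2y`), a dual path `Q` (step `f → f'` ↦ `2f+(1,1) → f+f'+(1,1) → 2f'+(1,1)`) and the
link `2v₀ → 2v₀ + u_{k₀} → centre` of the gate corner `c₀ = (v₀, k₀)` form ONE lattice walk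
(the fence), while the quadrant of the face `cFace c` at the vertex `v` of a corner `c = (v, k)`
becomes the unit face with lower-left corner `v + cFace c`; one step of the successor map moves
this sample face across exactly one edge of the scaled lattice (half of the target edge `cTgt c`
for a rotation, half of its dual edge for a translation).

This file: the `D4` table of coordinates of the unit vectors / corner offsets (`corner_coord_JF`),
unordered pairs and adjacency in coordinates, the edge separating two adjacent faces is
determined by the sum of its endpoints (`sepEdge_eq_of_sum_JF`), the scaled sample faces of a
corner, of its rotation successor and of its translation successor (adjacency and separating
edges: `sepEdge_sq_rot_JF`, `sepEdge_sq_trans_JF`), and the scaled copy of a lattice walk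
(`exists_scaleTwo_JF`, registered anchor).

References: H. Kesten, *Percolation theory for mathematicians* (1982), §2.2 (lattice Jordan
curve arguments by winding numbers); S. Smirnov, C. R. Acad. Sci. Paris 333 (2001), §2.
-/

set_option linter.unusedVariables false

namespace Summit.CriticalPhenomena.CardyFormulaZ2.Cruxes.EdgePrecompact.QkzStripBoundaryArm

open MeasureTheory Filter Set Metric
open scoped Topology BigOperators Pointwise
open Literature.Probability.LatticeModels Literature.Probability.Percolation
open Literature.Probability.RandomPlanarGeometry (DobrushinDomain)
open Summit.CriticalPhenomena.CardyFormulaZ2.Theses.CardyComplexCone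

noncomputable section

/-! ## Coordinates of the unit vectors and corner offsets -/

/-- **The `D4` table.** Coordinates of `cornerUnit (k + j)` and `cornerOff (k + j)`, `j = 0,…,3`,
for each `k : Fin 4` (so that identities between corners become linear integer arithmetic). -/
theorem corner_coord_JF (k : Fin 4) :
    (cornerUnit k 0 = 1 ∧ cornerUnit k 1 = 0 ∧ cornerUnit (k + 1) 0 = 0 ∧ cornerUnit (k + 1) 1 = 1 ∧
      cornerUnit (k + 2) 0 = -1 ∧ cornerUnit (k + 2) 1 = 0 ∧ cornerUnit (k + 3) 0 = 0 ∧ cornerUnit (k + 3) 1 = -1 ∧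
      cornerOff k 0 = 0 ∧ cornerOff k 1 = 0 ∧ cornerOff (k + 1) 0 = 1 ∧ cornerOff (k + 1) 1 = 0 ∧
      cornerOff (k + 2) 0 = 1 ∧ cornerOff (k + 2) 1 = 1 ∧ cornerOff (k + 3) 0 = 0 ∧ cornerOff (k + 3) 1 = 1) ∨
    (cornerUnit k 0 = 0 ∧ cornerUnit k 1 = 1 ∧ cornerUnit (k + 1) 0 = -1 ∧ cornerUnit (k + 1) 1 = 0 ∧
      cornerUnit (k + 2) 0 = 0 ∧ cornerUnit (k + 2) 1 = -1 ∧ cornerUnit (k + 3) 0 = 1 ∧ cornerUnit (k + 3) 1 = 0 ∧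
      cornerOff k 0 = 1 ∧ cornerOff k 1 = 0 ∧ cornerOff (k + 1) 0 = 1 ∧ cornerOff (k + 1) 1 = 1 ∧
      cornerOff (k + 2) 0 = 0 ∧ cornerOff (k + 2) 1 = 1 ∧ cornerOff (k + 3) 0 = 0 ∧ cornerOff (k + 3) 1 = 0) ∨
    (cornerUnit k 0 = -1 ∧ cornerUnit k 1 = 0 ∧ cornerUnit (k + 1) 0 = 0 ∧ cornerUnit (k + 1) 1 = -1 ∧
      cornerUnit (k + 2) 0 = 1 ∧ cornerUnit (k + 2) 1 = 0 ∧ cornerUnit (k + 3) 0 = 0 ∧ cornerUnit (k + 3) 1 = 1 ∧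
      cornerOff k 0 = 1 ∧ cornerOff k 1 = 1 ∧ cornerOff (k + 1) 0 = 0 ∧ cornerOff (k + 1) 1 = 1 ∧
      cornerOff (k + 2) 0 = 0 ∧ cornerOff (k + 2) 1 = 0 ∧ cornerOff (k + 3) 0 = 1 ∧ cornerOff (k + 3) 1 = 0) ∨
    (cornerUnit k 0 = 0 ∧ cornerUnit k 1 = -1 ∧ cornerUnit (k + 1) 0 = 1 ∧ cornerUnit (k + 1) 1 = 0 ∧
      cornerUnit (k + 2) 0 = 0 ∧ cornerUnit (k + 2) 1 = 1 ∧ cornerUnit (k + 3) 0 = -1 ∧ cornerUnit (k + 3) 1 = 0 ∧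
      cornerOff k 0 = 0 ∧ cornerOff k 1 = 1 ∧ cornerOff (k + 1) 0 = 0 ∧ cornerOff (k + 1) 1 = 0 ∧
      cornerOff (k + 2) 0 = 1 ∧ cornerOff (k + 2) 1 = 0 ∧ cornerOff (k + 3) 0 = 1 ∧ cornerOff (k + 3) 1 = 1) := by
  fin_cases k <;> decide

/-- Coordinates of the scaled sample face `v + cFace (v, k)` of a corner: `2v - cornerOff k`. -/
theorem sq_coord_JF (v : Site 2) (k : Fin 4) (i : Fin 2) : (v + cFace (v, k)) i = 2 * v i - cornerOff k i := by
  simp only [cFace, faceAt, Pi.add_apply, Pi.sub_apply]; ring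

/-- Equality of unordered pairs of sites, in coordinates. -/
theorem sym2_eq_iff_coord_JF {p q p' q' : Site 2} : s(p, q) = s(p', q') ↔
    (p 0 = p' 0 ∧ p 1 = p' 1 ∧ q 0 = q' 0 ∧ q 1 = q' 1) ∨ (p 0 = q' 0 ∧ p 1 = q' 1 ∧ q 0 = p' 0 ∧ q 1 = p' 1) := by
  rw [Sym2.eq_iff, Site.eq_iff_two, Site.eq_iff_two, Site.eq_iff_two, Site.eq_iff_two]; tauto

/-- Membership in an unordered pair of sites, in coordinates. -/
theorem sym2_mem_iff_coord_JF {x p q : Site 2} : x ∈ s(p, q) ↔ (x 0 = p 0 ∧ x 1 = p 1) ∨ (x 0 = q 0 ∧ x 1 = q 1) := by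
  rw [Sym2.mem_iff, Site.eq_iff_two, Site.eq_iff_two]

/-- Lattice adjacency in coordinates (the four unit steps). -/
theorem adj_iff_coord_JF {x y : Site 2} : (zdGraph 2).Adj x y ↔
    (y 0 = x 0 + 1 ∧ y 1 = x 1) ∨ (x 0 = y 0 + 1 ∧ y 1 = x 1) ∨ (y 1 = x 1 + 1 ∧ y 0 = x 0) ∨ (x 1 = y 1 + 1 ∧ y 0 = x 0) := by
  constructor
  · intro h
    rcases stepKind_of_adj h with ⟨h0, h1⟩ | ⟨h0, h1⟩ | ⟨h1, h0⟩ | ⟨h1, h0⟩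
    · exact Or.inl ⟨h0, h1⟩
    · exact Or.inr (Or.inl ⟨h0, h1⟩)
    · exact Or.inr (Or.inr (Or.inl ⟨h1, h0⟩))
    · exact Or.inr (Or.inr (Or.inr ⟨h1, h0⟩))
  · rintro (⟨h0, h1⟩ | ⟨h0, h1⟩ | ⟨h1, h0⟩ | ⟨h1, h0⟩)
    · exact adj_of_stepKind (.right h0 h1)
    · exact adj_of_stepKind (.left h0 h1)
    · exact adj_of_stepKind (.up h1 h0)
    · exact adj_of_stepKind (.down h1 h0)

/-! ## The primal edge separating two adjacent faces is determined by the sum of its endpoints -/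

/-- Two lattice edges with the same endpoint sum (twice the same midpoint) coincide. -/
theorem sym2_eq_of_sum_eq_JF {p q p' q' : Site 2} (h : (zdGraph 2).Adj p q) (h' : (zdGraph 2).Adj p' q')
    (hs : ∀ i, p i + q i = p' i + q' i) : s(p, q) = s(p', q') := by
  rw [sym2_eq_iff_coord_JF]
  have h0 := hs 0
  have h1 := hs 1
  rw [adj_iff_coord_JF] at h h'
  omega

/-- The two endpoints of `sepEdge z z'` are lattice neighbours. -/
theorem adj_sepLo_sepHi_JF (z z' : Site 2) : (zdGraph 2).Adj (sepLo z z') (sepHi z z') := by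
  rw [zdGraph_adj_iff]
  exact ⟨_, Or.inl rfl⟩

/-- For adjacent faces `z`, `z'` the endpoints of the separating edge sum to `z + z' + (1,1)`
(twice the midpoint of the edge = twice the midpoint of the dual edge). -/
theorem sepLo_add_sepHi_JF {z z' : Site 2} (h : (zdGraph 2).Adj z z') (i : Fin 2) :
    sepLo z z' i + sepHi z z' i = z i + z' i + 1 := by
  rw [adj_iff_coord_JF] at h
  fin_cases i <;>
  · simp only [sepLo, sepHi, Pi.add_apply, Pi.sup_apply, Fin.zero_eta, Fin.mk_one, Fin.isValue]
    split_ifs with hif <;> simp <;> omega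

/-- **The separating edge by its midpoint.** If `p`, `q` are lattice neighbours with
`p + q = z + z' + (1,1)` then `sepEdge z z' = {p, q}`. -/
theorem sepEdge_eq_of_sum_JF {z z' p q : Site 2} (h : (zdGraph 2).Adj z z') (hpq : (zdGraph 2).Adj p q)
    (hs : ∀ i, p i + q i = z i + z' i + 1) : sepEdge z z' = s(p, q) :=
  sym2_eq_of_sum_eq_JF (adj_sepLo_sepHi_JF z z') hpq fun i => by rw [sepLo_add_sepHi_JF h, hs]

/-! ## The scaled sample faces of a corner and of its two possible successors -/

/-- The target edge at a corner joins lattice neighbours. -/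
theorem adj_cTgt_JF (v : Site 2) (k : Fin 4) : (zdGraph 2).Adj v (v + cornerUnit (k + 1)) := by
  rw [adj_iff_coord_JF]
  simp only [Pi.add_apply]
  rcases corner_coord_JF k with h | h | h | h <;> omega

/-- **Rotation successor.** The sample face of `(v, k+1)` is the sample face of `(v, k)` moved by
`-cornerUnit k`. -/
theorem sq_rot_coord_JF (v : Site 2) (k : Fin 4) :
    (v + cFace (v, k + 1)) 0 = (v + cFace (v, k)) 0 - cornerUnit k 0 ∧
      (v + cFace (v, k + 1)) 1 = (v + cFace (v, k)) 1 - cornerUnit k 1 := by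
  simp only [cFace, faceAt, Pi.add_apply, Pi.sub_apply]
  rcases corner_coord_JF k with h | h | h | h <;> omega

/-- The two sample faces of a rotation step are adjacent scaled faces. -/
theorem adj_sq_rot_JF (v : Site 2) (k : Fin 4) : (zdGraph 2).Adj (v + cFace (v, k)) (v + cFace (v, k + 1)) := by
  rw [adj_iff_coord_JF]
  obtain ⟨e0, e1⟩ := sq_rot_coord_JF v k
  rcases corner_coord_JF k with h | h | h | h <;> omega

/-- **The edge crossed by a rotation step**: half of the target edge, `{2v, 2v + u_{k+1}}`. -/
theorem sepEdge_sq_rot_JF (v : Site 2) (k : Fin 4) :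
    sepEdge (v + cFace (v, k)) (v + cFace (v, k + 1)) = s(v + v, v + v + cornerUnit (k + 1)) := by
  refine sepEdge_eq_of_sum_JF (adj_sq_rot_JF v k) ?_ fun i => ?_
  · rw [adj_iff_coord_JF]
    simp only [Pi.add_apply]
    rcases corner_coord_JF k with h | h | h | h <;> omega
  · obtain ⟨e0, e1⟩ := sq_rot_coord_JF v k
    have f0 := sq_coord_JF v k 0
    have f1 := sq_coord_JF v k 1
    simp only [Pi.add_apply] at e0 e1 f0 f1
    fin_cases i <;> simp only [Pi.add_apply, Fin.zero_eta, Fin.mk_one, Fin.isValue] <;>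
      rcases corner_coord_JF k with h | h | h | h <;> omega

/-- **Translation successor.** The sample face of `(v + u_{k+1}, k + 3)` is the sample face of
`(v, k)` moved by `u_{k+1}` (the adjacent quadrant of the same face). -/
theorem sq_trans_coord_JF (v : Site 2) (k : Fin 4) :
    (v + cornerUnit (k + 1) + cFace (v + cornerUnit (k + 1), k + 3)) 0 = (v + cFace (v, k)) 0 + cornerUnit (k + 1) 0 ∧
      (v + cornerUnit (k + 1) + cFace (v + cornerUnit (k + 1), k + 3)) 1 = (v + cFace (v, k)) 1 + cornerUnit (k + 1) 1 := by
  simp only [cFace, faceAt, Pi.add_apply, Pi.sub_apply]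
  rcases corner_coord_JF k with h | h | h | h <;> omega

/-- The two sample faces of a translation step are adjacent scaled faces. -/
theorem adj_sq_trans_JF (v : Site 2) (k : Fin 4) :
    (zdGraph 2).Adj (v + cFace (v, k)) (v + cornerUnit (k + 1) + cFace (v + cornerUnit (k + 1), k + 3)) := by
  rw [adj_iff_coord_JF]
  obtain ⟨e0, e1⟩ := sq_trans_coord_JF v k
  rcases corner_coord_JF k with h | h | h | h <;> omega

/-- **The edge crossed by a translation step**: half of the dual edge of the target edge,
`{2v + u_{k+1}, 2v + u_k + u_{k+1}}` (from the midpoint of `cTgt` to the centre of the face). -/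
theorem sepEdge_sq_trans_JF (v : Site 2) (k : Fin 4) :
    sepEdge (v + cFace (v, k)) (v + cornerUnit (k + 1) + cFace (v + cornerUnit (k + 1), k + 3)) =
      s(v + v + cornerUnit (k + 1), v + v + cornerUnit k + cornerUnit (k + 1)) := by
  refine sepEdge_eq_of_sum_JF (adj_sq_trans_JF v k) ?_ fun i => ?_
  · rw [adj_iff_coord_JF]
    simp only [Pi.add_apply]
    rcases corner_coord_JF k with h | h | h | h <;> omega
  · obtain ⟨e0, e1⟩ := sq_trans_coord_JF v k
    have f0 := sq_coord_JF v k 0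
    have f1 := sq_coord_JF v k 1
    simp only [Pi.add_apply] at e0 e1 f0 f1
    fin_cases i <;> simp only [Pi.add_apply, Fin.zero_eta, Fin.mk_one, Fin.isValue] <;>
      rcases corner_coord_JF k with h | h | h | h <;> omega

/-- The centre of the face of a corner: `2v + u_k + u_{k+1} = 2 cFace (v,k) + (1,1)`. -/
theorem centre_coord_JF (v : Site 2) (k : Fin 4) :
    (v + v + cornerUnit k + cornerUnit (k + 1)) 0 = 2 * cFace (v, k) 0 + 1 ∧
      (v + v + cornerUnit k + cornerUnit (k + 1)) 1 = 2 * cFace (v, k) 1 + 1 := by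
  simp only [cFace, faceAt, Pi.add_apply, Pi.sub_apply]
  rcases corner_coord_JF k with h | h | h | h <;> omega

/-- The vertex and the far end of the target edge are corners of the face: their coordinates lie
in `[cFace, cFace + 1]`. -/
theorem vertex_coord_JF (v : Site 2) (k : Fin 4) :
    (cFace (v, k) 0 ≤ v 0 ∧ v 0 ≤ cFace (v, k) 0 + 1 ∧
      cFace (v, k) 0 ≤ v 0 + cornerUnit (k + 1) 0 ∧ v 0 + cornerUnit (k + 1) 0 ≤ cFace (v, k) 0 + 1) ∧
    (cFace (v, k) 1 ≤ v 1 ∧ v 1 ≤ cFace (v, k) 1 + 1 ∧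
      cFace (v, k) 1 ≤ v 1 + cornerUnit (k + 1) 1 ∧ v 1 + cornerUnit (k + 1) 1 ≤ cFace (v, k) 1 + 1) := by
  simp only [cFace, faceAt, Pi.sub_apply]
  rcases corner_coord_JF k with h | h | h | h <;> omega

/-! ## The scaled walk of a lattice walk -/

/-- First half of a scaled edge is a lattice step. -/
theorem adj_scale_fst_JF {u v : Site 2} (h : (zdGraph 2).Adj u v) (t : Site 2) :
    (zdGraph 2).Adj (u + u + t) (u + v + t) := by
  rw [adj_iff_coord_JF] at h ⊢
  simp only [Pi.add_apply]
  omega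

/-- Second half of a scaled edge is a lattice step. -/
theorem adj_scale_snd_JF {u v : Site 2} (h : (zdGraph 2).Adj u v) (t : Site 2) :
    (zdGraph 2).Adj (u + v + t) (v + v + t) := by
  rw [adj_iff_coord_JF] at h ⊢
  simp only [Pi.add_apply]
  omega

/-- **The scaled (and translated) walk** (registered anchor `exists_scaleTwo_JF` of
stmt-CriticalPhenomena-11387): a lattice walk `p` from `a` to `b` has a scaled copy from
`2a + t` to `2b + t` (each edge `{x, y}` replaced by the two steps `2x + t → x + y + t → 2y + t`),
every edge of which is half of a scaled edge of `p` and every vertex of which is a scaled vertex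
or a scaled edge-midpoint of `p`. -/
theorem exists_scaleTwo_JF : ∀ (t a b : Site 2) (p : (zdGraph 2).Walk a b), ∃ w : (zdGraph 2).Walk (a + a + t) (b + b + t), (∀ e ∈ w.edges, ∃ d ∈ p.darts, e = s(d.fst + d.fst + t, d.fst + d.snd + t) ∨ e = s(d.fst + d.snd + t, d.snd + d.snd + t)) ∧ (∀ z ∈ w.support, (∃ x ∈ p.support, z = x + x + t) ∨ (∃ d ∈ p.darts, z = d.fst + d.snd + t)) := by
  intro t a b p
  induction p with
  | nil =>
    rename_i u
    refine ⟨SimpleGraph.Walk.nil, fun e he => by simp at he, fun z hz => Or.inl ⟨u, by simp, ?_⟩⟩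
    simpa using hz
  | cons h p ih =>
    rename_i u v w
    obtain ⟨q, hqe, hqs⟩ := ih
    refine ⟨SimpleGraph.Walk.cons (adj_scale_fst_JF h t) (SimpleGraph.Walk.cons (adj_scale_snd_JF h t) q), ?_, ?_⟩
    · intro e he
      simp only [SimpleGraph.Walk.edges_cons, List.mem_cons] at he
      rcases he with rfl | rfl | he
      · exact ⟨⟨(u, v), h⟩, by simp, Or.inl rfl⟩
      · exact ⟨⟨(u, v), h⟩, by simp, Or.inr rfl⟩
      · obtain ⟨d, hd, hd'⟩ := hqe e he
        exact ⟨d, by simp [hd], hd'⟩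
    · intro z hz
      simp only [SimpleGraph.Walk.support_cons, List.mem_cons] at hz
      rcases hz with rfl | rfl | hz
      · exact Or.inl ⟨u, by simp, rfl⟩
      · exact Or.inr ⟨⟨(u, v), h⟩, by simp, rfl⟩
      · rcases hqs z hz with ⟨x, hx, rfl⟩ | ⟨d, hd, rfl⟩
        · exact Or.inl ⟨x, by simp [hx], rfl⟩
        · exact Or.inr ⟨d, by simp [hd], rfl⟩

end

end Summit.CriticalPhenomena.CardyFormulaZ2.Cruxes.EdgePrecompact.QkzStripBoundaryArm
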